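import Summits.MatrixMultiplication.OmegaCensus.STPPVosperSlackTwoCheckersT
import Summits.MatrixMultiplication.OmegaCensus.STPPVosperSlackTwoTablesZ53
import Summits.MatrixMultiplication.OmegaCensus.STPPVosperSlackTwoLawABQ

/-!
# ω-census (abelian STPP census): ℤ₅₃ leaf {(2,3,3)³} — slack-2 three-block law, case A rows up to dihedral symmetry, part 1 of 1 (kernel computations)

HONEST FRAMING (pub-omega census; verbatim): lottery ticket; floor = certified bounds/negative ranges.
Census STRUCTURE (seat pub-omega-stpp-2 gen 31, 2026-08-29), family (b2).  Rows for the three-block slack-2 law `no_isSTPP_of_slack_two_tables` (`STPPVosperSlackTwoLawT.lean`, stpp-1 g33) at the ℤ₅₃ leaf `{(2,3,3)³}`: checker `caseADeadT` of `STPPVosperSlackTwoCheckersT.lean`, dead table `tblZ53A` of `…TablesZ53.lean`; block i = a (2,3,3) block read directly (`a = 2`), others (2,3,3),(2,3,3), `L = 18`, `z = 12`: `dihedralSmaller 53 Q || caseADeadT 53 2 3 18 12 Q tblZ53A` over `qShapes 53 3` (1326 shapes, 234 dihedral representatives; python mirror 19 559 nodes, HOME `pub-omega-stpp-2-g31/c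ode/s2/`).
Each theorem is ONE `decide +kernel` over one chunk of shapes (sized by the python cost mirror).  Assembly in `STPPVosperSlackTwoRows53AAsm.lean`.  Nothing here is progress on `ω`.
-/

namespace Summit.MatrixMultiplication.OmegaCensus.CubeNB.S2

/-- Rows chunk `[0, 450)`: every entry passes the kernel test. [folklore] -/
theorem rows53A_c0 : ((qShapes 53 3 0 450).all fun Q => dihedralSmaller 53 Q || caseADeadT 53 2 3 18 12 Q tblZ53A) = true := by
  decide +kernel

/-- Rows chunk `[450, 900)`: every entry passes the kernel test. [folklore] -/
theorem rows53A_c1 : ((qShapes 53 3 450 900).all fun Q => dihedralSmaller 53 Q || caseADeadT 53 2 3 18 12 Q tblZ53A) = true := by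
  decide +kernel

/-- Rows chunk `[900, 1123)`: every entry passes the kernel test. [folklore] -/
theorem rows53A_c2 : ((qShapes 53 3 900 1123).all fun Q => dihedralSmaller 53 Q || caseADeadT 53 2 3 18 12 Q tblZ53A) = true := by
  decide +kernel

/-- Rows chunk `[1123, 1264)`: every entry passes the kernel test. [folklore] -/
theorem rows53A_c3 : ((qShapes 53 3 1123 1264).all fun Q => dihedralSmaller 53 Q || caseADeadT 53 2 3 18 12 Q tblZ53A) = true := by
  decide +kernel

/-- Rows chunk `[1264, 1326)`: every entry passes the kernel test. [folklore] -/
theorem rows53A_c4 : ((qShapes 53 3 1264 1326).all fun Q => dihedralSmaller 53 Q || caseADeadT 53 2 3 18 12 Q tblZ53A) = true := by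
  decide +kernel

end Summit.MatrixMultiplication.OmegaCensus.CubeNB.S2
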